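import Mathlib.LinearAlgebra.Matrix.Kronecker
import Mathlib.LinearAlgebra.Matrix.Determinant.Basic
import Literature.Computability.AlgebraicComplexity.MatrixMultiplicationExponent

set_option linter.dupNamespace false
set_option autoImplicit false

/-!
# Obstruction descent — the MATRIX-MULTIPLICATION POINT of the blow-up dictionary: `D_X(⟨k,n,n⟩) = det(𝕏)^k` (decomp-mm · lens 3 · gen 47, def-free)

`route-MatrixMultiplication-ObstructionDescent`, crux `NoOccurrenceObstruction` (`P_O`, stmt 29040); NODE-g47 §3.  The
two-rectangular sector of the obstruction calculus (NODE-g45; `…TwoRectangleDetInvariants`, `…TwoRectangleStorey`,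
`…TwoRectangleBlowUp*`) reads a weight vector of type `((δ^N),(δ^N),ν)` through the BLOW-UP DETERMINANTS
`D_X(t) = det(Σ_l X_l ⊗ T_l)`, `X = (X_l)_l` a tuple of `δ × δ` matrices indexed by the letters `l` of the third leg,
`T_l = (t_{i j l})_{i,j}` the slices of `t`.  This file computes the dictionary AT THE MATRIX MULTIPLICATION TENSOR, for every
width `δ` at once and over any commutative ring:

* `kroneckerSum_slice_matMulTensor_reindex` — for `t = ⟨k,n,n⟩` (letters `l = (μ,ν) ∈ [n]×[n]`, rows `(κ,ν')`, columns
  `(κ',μ')`), the matrix `Σ_l X_l ⊗ T_l` is, after the reindexing `(p,(κ,ν)) ↦ ((p,ν),κ)`, block diagonal with `k` equal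
  diagonal blocks `𝕏`, where **`𝕏 ∈ Mat_{δn}` is the block matrix whose `(ν,μ)` block is `X_{(μ,ν)}`**
  (`𝕏_{(p,ν),(q,μ)} = (X_{(μ,ν)})_{p q}`) — the tensor `⟨k,n,n⟩` is the direct sum, over the row index `κ`, of `k` copies of
  `⟨1,n,n⟩` with the third leg shared;
* `det_kroneckerSum_slice_matMulTensor` — hence **`D_X(⟨k,n,n⟩) = det(𝕏)^k`**; in particular `D_X(⟨1,n,n⟩) = det 𝕏` is the
  determinant of the GENERIC `δ × δ`-BLOCK MATRIX of size `n` (`det_kroneckerSum_slice_matMulTensor_one`), and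
  `D_X(⟨n,n,n⟩) = det(𝕏)^n` (`det_kroneckerSum_slice_matMulTensor_square`).

Reading (NODE-g47 §3): by the thin-slot law (`ObstructionDescentThinTypes`) the two-rectangular part of the residual of `P_O`
consists of the widths `δ > m/n²` only, and on the corner format `n²` it reads, through the duality dictionary of NODE-g45
(paper level: Domokos–Zubkov / Schofield–Van den Bergh spanning, Goodman–Wallach duality), as the statement that every
`GL_{n²}`-type of the span of the translates `X ↦ det(𝕏(g·X))^n`, `g ∈ GL_{n²}` acting on the letter index, lies in the span of
the blow-up determinants of tensors of rank `≤ m` — the matrix-multiplication side of the sector is ONE explicit polynomial per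
width, a power of a generic block determinant (this file = the kernel part of that sentence).  No definition is introduced (`𝕏` is inlined as `Matrix.of …`); no `def`; sorry-free;
axioms standard.  Nothing here proves `ω = 2` or closes an item.
[cite: BurgisserIkenmeyer2011, §3.1, §5] [cite: Blaser2013, §5 (the tensor ⟨k,m,n⟩)]
-/

namespace Summit.MatrixMultiplication.MatrixMultiplication.Theorems.ObstructionDescentMatMulBlowUp

open Matrix BigOperators
open scoped Kronecker
open Literature.Computability.AlgebraicComplexity (matMulTensor)

variable {R : Type*} [CommRing R]

/-- The slice of `⟨k,n,n⟩` at the letter `l = (μ,ν)`: entry `[(κ,ν'),(κ',μ')] = [κ = κ' ∧ μ' = μ ∧ ν' = ν]`. [bookkeeping] -/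
theorem slice_matMulTensor_apply (k n : ℕ) (l : Fin n × Fin n) (a b : Fin k × Fin n) :
    Matrix.of (fun i j : Fin k × Fin n => matMulTensor R k n n i j l) a b =
      if a.1 = b.1 ∧ b.2 = l.1 ∧ a.2 = l.2 then 1 else 0 := by
  simp [matMulTensor]

/-- **Block structure.**  After the reindexing `(p,(κ,ν)) ↦ ((p,ν),κ)` of rows and columns, `Σ_l X_l ⊗ T_l` for `t = ⟨k,n,n⟩` is
block diagonal with `k` copies of the block matrix `𝕏`, `𝕏_{(p,ν),(q,μ)} = (X_{(μ,ν)})_{pq}` — `⟨k,n,n⟩` is the direct sum over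
the row index `κ` of `k` copies of `⟨1,n,n⟩` sharing the third leg. [this node] -/
theorem kroneckerSum_slice_matMulTensor_reindex (k n δ : ℕ) (X : Fin n × Fin n → Matrix (Fin δ) (Fin δ) R) :
    Matrix.reindex
        (Equiv.mk (fun x : Fin δ × (Fin k × Fin n) => ((x.1, x.2.2), x.2.1))
          (fun y : (Fin δ × Fin n) × Fin k => (y.1.1, (y.2, y.1.2))) (fun _ => rfl) (fun _ => rfl))
        (Equiv.mk (fun x : Fin δ × (Fin k × Fin n) => ((x.1, x.2.2), x.2.1))
          (fun y : (Fin δ × Fin n) × Fin k => (y.1.1, (y.2, y.1.2))) (fun _ => rfl) (fun _ => rfl))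
        (∑ l : Fin n × Fin n, X l ⊗ₖ Matrix.of (fun i j : Fin k × Fin n => matMulTensor R k n n i j l)) =
      Matrix.blockDiagonal (fun _ : Fin k => Matrix.of fun (r s : Fin δ × Fin n) => X (s.2, r.2) r.1 s.1) := by
  classical
  ext ⟨⟨p, ν⟩, κ⟩ ⟨⟨q, μ⟩, κ'⟩
  simp only [Matrix.reindex_apply, Matrix.submatrix_apply, Equiv.coe_fn_symm_mk, Matrix.sum_apply,
    Matrix.kroneckerMap_apply, Matrix.of_apply, matMulTensor, Matrix.blockDiagonal_apply, mul_ite, mul_one, mul_zero]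
  rw [Finset.sum_eq_single (μ, ν)]
  · by_cases h : κ = κ' <;> simp [h]
  · rintro ⟨μ₁, ν₁⟩ - hl
    have : ¬(κ = κ' ∧ μ = μ₁ ∧ ν = ν₁) := fun h => hl (by rw [h.2.1, h.2.2])
    simp only [this, if_false]
  · intro h; exact absurd (Finset.mem_univ _) h

/-- **`D_X(⟨k,n,n⟩) = det(𝕏)^k`** for every width `δ`, every `k, n` and every letter tuple `X` of `δ × δ` matrices, where `𝕏` is
the `δ × δ`-block matrix of size `n` with `(ν,μ)` block `X_{(μ,ν)}`. [this node] -/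
theorem det_kroneckerSum_slice_matMulTensor (k n δ : ℕ) (X : Fin n × Fin n → Matrix (Fin δ) (Fin δ) R) :
    (∑ l : Fin n × Fin n, X l ⊗ₖ Matrix.of (fun i j : Fin k × Fin n => matMulTensor R k n n i j l)).det =
      (Matrix.of fun (r s : Fin δ × Fin n) => X (s.2, r.2) r.1 s.1).det ^ k := by
  classical
  rw [← Matrix.det_reindex_self
    (Equiv.mk (fun x : Fin δ × (Fin k × Fin n) => ((x.1, x.2.2), x.2.1))
      (fun y : (Fin δ × Fin n) × Fin k => (y.1.1, (y.2, y.1.2))) (fun _ => rfl) (fun _ => rfl)),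
    kroneckerSum_slice_matMulTensor_reindex, Matrix.det_blockDiagonal, Finset.prod_const, Finset.card_univ,
    Fintype.card_fin]

/-- `⟨1,n,n⟩`: **the blow-up determinant of the identity tensor of `Mat_n` is the generic block determinant**,
`D_X(⟨1,n,n⟩) = det 𝕏`. [this node] -/
theorem det_kroneckerSum_slice_matMulTensor_one (n δ : ℕ) (X : Fin n × Fin n → Matrix (Fin δ) (Fin δ) R) :
    (∑ l : Fin n × Fin n, X l ⊗ₖ Matrix.of (fun i j : Fin 1 × Fin n => matMulTensor R 1 n n i j l)).det =
      (Matrix.of fun (r s : Fin δ × Fin n) => X (s.2, r.2) r.1 s.1).det := by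
  rw [det_kroneckerSum_slice_matMulTensor, pow_one]

/-- `⟨n,n,n⟩`: **`D_X(⟨n,n,n⟩) = det(𝕏)^n`** — the matrix-multiplication point of the two-rectangular dictionary, all widths.
[this node] -/
theorem det_kroneckerSum_slice_matMulTensor_square (n δ : ℕ) (X : Fin n × Fin n → Matrix (Fin δ) (Fin δ) R) :
    (∑ l : Fin n × Fin n, X l ⊗ₖ Matrix.of (fun i j : Fin n × Fin n => matMulTensor R n n n i j l)).det =
      (Matrix.of fun (r s : Fin δ × Fin n) => X (s.2, r.2) r.1 s.1).det ^ n :=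
  det_kroneckerSum_slice_matMulTensor n n δ X

/-- **Vanishing is width-free**: `D_X(⟨k,n,n⟩) = 0 ⟺ det 𝕏 = 0` for `k ≥ 1` over a reduced ring (e.g. a field) — the blow-up
determinants of all the tensors `⟨k,n,n⟩`, `k ≥ 1`, cut out the same hypersurface in letter space. [this node] -/
theorem det_kroneckerSum_slice_matMulTensor_eq_zero_iff {F : Type*} [Field F] {k : ℕ} (hk : k ≠ 0) (n δ : ℕ)
    (X : Fin n × Fin n → Matrix (Fin δ) (Fin δ) F) :
    (∑ l : Fin n × Fin n, X l ⊗ₖ Matrix.of (fun i j : Fin k × Fin n => matMulTensor F k n n i j l)).det = 0 ↔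
      (Matrix.of fun (r s : Fin δ × Fin n) => X (s.2, r.2) r.1 s.1).det = 0 := by
  rw [det_kroneckerSum_slice_matMulTensor, pow_eq_zero_iff hk]

/-- **The matrix-multiplication point is live at every width**: at the letter tuple `X_{(μ,ν)} = [μ = ν]·1_δ` the block matrix
`𝕏` is the identity, so `D_X(⟨k,n,n⟩) = 1 ≠ 0` — for every `δ` and `k` the blow-up determinant family does not vanish
identically at `⟨k,n,n⟩`. [this node] -/
theorem det_kroneckerSum_slice_matMulTensor_blockOne (k n δ : ℕ) :
    (∑ l : Fin n × Fin n, (if l.1 = l.2 then (1 : Matrix (Fin δ) (Fin δ) R) else 0) ⊗ₖ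
        Matrix.of (fun i j : Fin k × Fin n => matMulTensor R k n n i j l)).det = 1 := by
  classical
  rw [det_kroneckerSum_slice_matMulTensor]
  have h1 : (Matrix.of fun (r s : Fin δ × Fin n) =>
      (if (s.2, r.2).1 = (s.2, r.2).2 then (1 : Matrix (Fin δ) (Fin δ) R) else 0) r.1 s.1) = 1 := by
    ext ⟨p, ν⟩ ⟨q, μ⟩
    simp only [Matrix.of_apply, Matrix.one_apply, Prod.mk.injEq]
    by_cases h : μ = ν
    · subst h
      by_cases h' : p = q <;> simp [h', Matrix.one_apply]
    · have h2 : ¬ν = μ := fun e => h e.symm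
      simp [h, h2]
  rw [h1, Matrix.det_one, one_pow]

end Summit.MatrixMultiplication.MatrixMultiplication.Theorems.ObstructionDescentMatMulBlowUp
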